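import Literature.NumberTheory.LFunctions.KMVCutoffW
import Mathlib.Analysis.Calculus.ParametricIntegral
import Mathlib.Analysis.Calculus.ContDiff.Deriv
import HarnessLib

/-!
# KMV's cut-off `W(y) = ∫₀^∞ e^{−u−y/u} du` is smooth on `(0, ∞)`: derivatives under the integral sign

Kowalski–Michel–VanderKam, *Mollification of the fourth moment of automorphic `L`-functions and
arithmetic applications*, Invent. Math. 142 (2000), (21)–(22) p. 12: the cut-off `W` of the exact
formula for `Λ(f,½)²` (the tree's `KMV2000.cutoffW`, real form `∫₀^∞ e^{−u−y/u} du = 2√y K₁(2√y)`,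
file `KMVCentralValueSquaredAFE.lean`; bounds and monotonicity in `KMVCutoffW.lean`, Mellin forms in
`KMVCutoffWMellin.lean`). Printed (22): «`W` … is smooth and decays faster than any negative power of
`y`». The decay is in the tree (`cutoffW_le_two_mul_exp_neg_sqrt`); this proofs-only file supplies the
SMOOTHNESS, which every Poisson-summation treatment of the off-diagonal of the second moment needs
(summit Parity, route `PrimeLevelFamEdge`, crux K_B, plan Ω — but nothing here refers to it):

* the family of integrals `W_n(y) = ∫₀^∞ u^{−n} e^{−u−y/u} du` (written inline, no definition), with the
  pointwise bound `u^{−k} e^{−a/u} ≤ k!·a^{−k}` (private `inv_pow_mul_exp_neg_div_le`) that dominates the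
  `y`-derivatives on `y > a`;
* `integrableOn_inv_pow_mul_exp` — `W_n(y)` converges absolutely for `y > 0`;
* **`hasDerivAt_cutoffWFamily`** — `W_n'(y) = −W_{n+1}(y)` for `y > 0` (dominated differentiation,
  Mathlib `hasDerivAt_integral_of_dominated_loc_of_deriv_le`);
* **`contDiffOn_cutoffWFamily`**, **`contDiffOn_cutoffW`** — every `W_n`, in particular `W = W_0`, is
  `C^∞` on `(0, ∞)`; `hasDerivAt_cutoffW` — `W'(y) = −∫₀^∞ u^{−1} e^{−u−y/u} du`.

Everything is PROVED; no definitions, no named facts.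

## References
* E. Kowalski, P. Michel, J. VanderKam, Invent. Math. 142 (2000) 95–151, (21)–(22) p. 12.
  [cite: KowalskiMichelVanderKam2000, (21)–(22) p. 12]
-/

noncomputable section

open Set MeasureTheory Filter Real
open scoped Topology ContDiff Nat

namespace Literature.NumberTheory.LFunctions.KMV2000

/-! ### The dominating bound `u^{−k} e^{−a/u} ≤ k! a^{−k}` -/

/-- For `a > 0`, `u > 0` and `k ∈ ℕ`: `u^{−k} e^{−a/u} ≤ k! · a^{−k}` (from `xᵏ/k! ≤ eˣ` at `x = a/u`).
[folklore] -/
private theorem inv_pow_mul_exp_neg_div_le {a u : ℝ} (ha : 0 < a) (hu : 0 < u) (k : ℕ) :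
    (u ^ k)⁻¹ * Real.exp (-(a / u)) ≤ (k ! : ℝ) * (a ^ k)⁻¹ := by
  have hx : 0 ≤ a / u := div_nonneg ha.le hu.le
  have h := Real.pow_div_factorial_le_exp (a / u) hx k
  -- `(a/u)^k / k! ≤ e^{a/u}` ⇒ `u^{-k} e^{-a/u} ≤ k!/a^k`
  have hk : (0 : ℝ) < k ! := by exact_mod_cast Nat.factorial_pos k
  have hak : 0 < a ^ k := pow_pos ha k
  have huk : 0 < u ^ k := pow_pos hu k
  rw [div_pow, div_le_iff₀ hk] at h
  have h2 : a ^ k ≤ Real.exp (a / u) * k ! * u ^ k := by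
    have := (div_le_iff₀ huk).mp h; linarith
  rw [Real.exp_neg]
  have hexp : 0 < Real.exp (a / u) := Real.exp_pos _
  calc (u ^ k)⁻¹ * (Real.exp (a / u))⁻¹ = (Real.exp (a / u) * u ^ k)⁻¹ := by
        rw [mul_inv, mul_comm]
    _ ≤ ((a ^ k) / k !)⁻¹ := by
        refine inv_anti₀ (by positivity) ?_
        rw [div_le_iff₀ hk]
        linarith
    _ = (k ! : ℝ) * (a ^ k)⁻¹ := by rw [inv_div, div_eq_mul_inv]

/-- The integrand `u ↦ u^{−n} e^{−u−y/u}` of `W_n` is continuous on `(0, ∞)`.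
[cite: KowalskiMichelVanderKam2000, (21) p. 12] -/
theorem continuousOn_inv_pow_mul_exp (n : ℕ) (y : ℝ) :
    ContinuousOn (fun u : ℝ ↦ (u ^ n)⁻¹ * Real.exp (-u - y / u)) (Ioi 0) := by
  refine ContinuousOn.mul ?_ (continuousOn_exp_neg_sub_div y)
  exact (continuousOn_id.pow n).inv₀ fun u hu ↦ (pow_pos (mem_Ioi.mp hu) n).ne'

/-- On `y > a > 0` the integrand of `W_n` is dominated by `n!·a^{−n}·e^{−u}`.
[cite: KowalskiMichelVanderKam2000, (21)–(22) p. 12] -/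
theorem norm_inv_pow_mul_exp_le {a y u : ℝ} (ha : 0 < a) (hay : a ≤ y) (hu : 0 < u) (n : ℕ) :
    ‖(u ^ n)⁻¹ * Real.exp (-u - y / u)‖ ≤ (n ! : ℝ) * (a ^ n)⁻¹ * Real.exp (-u) := by
  have hpos : 0 ≤ (u ^ n)⁻¹ * Real.exp (-u - y / u) := by positivity
  rw [Real.norm_of_nonneg hpos]
  have h1 : Real.exp (-u - y / u) ≤ Real.exp (-(a / u)) * Real.exp (-u) := by
    rw [← Real.exp_add]
    refine Real.exp_le_exp.mpr ?_
    have : a / u ≤ y / u := div_le_div_of_nonneg_right hay hu.le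
    linarith
  calc (u ^ n)⁻¹ * Real.exp (-u - y / u) ≤ (u ^ n)⁻¹ * (Real.exp (-(a / u)) * Real.exp (-u)) :=
        mul_le_mul_of_nonneg_left h1 (by positivity)
    _ = ((u ^ n)⁻¹ * Real.exp (-(a / u))) * Real.exp (-u) := by ring
    _ ≤ (n ! : ℝ) * (a ^ n)⁻¹ * Real.exp (-u) :=
        mul_le_mul_of_nonneg_right (inv_pow_mul_exp_neg_div_le ha hu n) (Real.exp_pos _).le

/-- `W_n(y) = ∫₀^∞ u^{−n} e^{−u−y/u} du` converges absolutely for `y > 0`.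
[cite: KowalskiMichelVanderKam2000, (21)–(22) p. 12] -/
theorem integrableOn_inv_pow_mul_exp (n : ℕ) {y : ℝ} (hy : 0 < y) :
    IntegrableOn (fun u : ℝ ↦ (u ^ n)⁻¹ * Real.exp (-u - y / u)) (Ioi 0) := by
  refine Integrable.mono' (integrableOn_exp_neg_Ioi.const_mul ((n ! : ℝ) * (y ^ n)⁻¹))
    ((continuousOn_inv_pow_mul_exp n y).aestronglyMeasurable measurableSet_Ioi) ?_
  refine (ae_restrict_iff' measurableSet_Ioi).mpr (ae_of_all _ fun u hu ↦ ?_)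
  exact norm_inv_pow_mul_exp_le hy le_rfl hu n

/-! ### Differentiation under the integral sign -/

/-- The `y`-derivative of the integrand: `d/dy [u^{−n} e^{−u−y/u}] = −u^{−(n+1)} e^{−u−y/u}` (`u ≠ 0`).
[folklore] -/
private theorem hasDerivAt_integrand {u : ℝ} (hu : u ≠ 0) (n : ℕ) (y : ℝ) :
    HasDerivAt (fun y : ℝ ↦ (u ^ n)⁻¹ * Real.exp (-u - y / u))
      (-((u ^ (n + 1))⁻¹ * Real.exp (-u - y / u))) y := by
  have h1 : HasDerivAt (fun y : ℝ ↦ -u - y / u) (-(1 / u)) y :=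
    ((hasDerivAt_id' y).div_const u).const_sub (-u)
  have h2 := (h1.exp).const_mul ((u ^ n)⁻¹)
  refine h2.congr_deriv ?_
  rw [pow_succ, mul_inv]
  field_simp

/-- **`W_n'(y) = −W_{n+1}(y)` for `y > 0`** (differentiation under the integral sign, dominated on
`y > y₀/2` by `(n+1)!·(y₀/2)^{−(n+1)}·e^{−u}`). [cite: KowalskiMichelVanderKam2000, (21)–(22) p. 12] -/
theorem hasDerivAt_cutoffWFamily (n : ℕ) {y₀ : ℝ} (hy₀ : 0 < y₀) :
    HasDerivAt (fun y : ℝ ↦ ∫ u in Ioi (0 : ℝ), (u ^ n)⁻¹ * Real.exp (-u - y / u))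
      (-(∫ u in Ioi (0 : ℝ), (u ^ (n + 1))⁻¹ * Real.exp (-u - y₀ / u))) y₀ := by
  have ha : 0 < y₀ / 2 := by linarith
  have hs : Ioi (y₀ / 2) ∈ 𝓝 y₀ := Ioi_mem_nhds (by linarith)
  have key := hasDerivAt_integral_of_dominated_loc_of_deriv_le (μ := volume.restrict (Ioi (0 : ℝ)))
    (F := fun (y u : ℝ) ↦ (u ^ n)⁻¹ * Real.exp (-u - y / u))
    (F' := fun (y u : ℝ) ↦ -((u ^ (n + 1))⁻¹ * Real.exp (-u - y / u)))
    (bound := fun u : ℝ ↦ ((n + 1) ! : ℝ) * ((y₀ / 2) ^ (n + 1))⁻¹ * Real.exp (-u)) hs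
    (Eventually.of_forall fun y ↦
      (continuousOn_inv_pow_mul_exp n y).aestronglyMeasurable measurableSet_Ioi)
    (integrableOn_inv_pow_mul_exp n hy₀)
    (((continuousOn_inv_pow_mul_exp (n + 1) y₀).neg).aestronglyMeasurable measurableSet_Ioi)
    ((ae_restrict_iff' measurableSet_Ioi).mpr (ae_of_all _ fun u hu y hy ↦ by
      rw [norm_neg]
      exact norm_inv_pow_mul_exp_le ha (le_of_lt (mem_Ioi.mp hy)) hu (n + 1)))
    (integrableOn_exp_neg_Ioi.const_mul _)
    ((ae_restrict_iff' measurableSet_Ioi).mpr (ae_of_all _ fun u hu y _ ↦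
      hasDerivAt_integrand (ne_of_gt (mem_Ioi.mp hu)) n y))
  have h := key.2
  rw [integral_neg] at h
  exact h

/-- For `y > 0`, on `(0,∞)`: `deriv W_n = −W_{n+1}`. [cite: KowalskiMichelVanderKam2000, (21)–(22) p. 12] -/
theorem deriv_cutoffWFamily (n : ℕ) {y : ℝ} (hy : 0 < y) :
    deriv (fun y : ℝ ↦ ∫ u in Ioi (0 : ℝ), (u ^ n)⁻¹ * Real.exp (-u - y / u)) y =
      -(∫ u in Ioi (0 : ℝ), (u ^ (n + 1))⁻¹ * Real.exp (-u - y / u)) :=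
  (hasDerivAt_cutoffWFamily n hy).deriv

/-- Every `W_n` is differentiable on `(0, ∞)`. [cite: KowalskiMichelVanderKam2000, (21)–(22) p. 12] -/
theorem differentiableOn_cutoffWFamily (n : ℕ) :
    DifferentiableOn ℝ (fun y : ℝ ↦ ∫ u in Ioi (0 : ℝ), (u ^ n)⁻¹ * Real.exp (-u - y / u)) (Ioi 0) :=
  fun _ hy ↦ (hasDerivAt_cutoffWFamily n (mem_Ioi.mp hy)).differentiableAt.differentiableWithinAt

/-! ### Smoothness -/

/-- Every `W_n` is `C^m` on `(0, ∞)` for every finite `m` (induction on `m` through `W_n' = −W_{n+1}`).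
[cite: KowalskiMichelVanderKam2000, (22) p. 12] -/
theorem contDiffOn_cutoffWFamily_nat (m : ℕ) : ∀ n : ℕ,
    ContDiffOn ℝ m (fun y : ℝ ↦ ∫ u in Ioi (0 : ℝ), (u ^ n)⁻¹ * Real.exp (-u - y / u)) (Ioi 0) := by
  induction m with
  | zero =>
    intro n
    exact contDiffOn_zero.mpr (differentiableOn_cutoffWFamily n).continuousOn
  | succ m ih =>
    intro n
    have hcast : ((m + 1 : ℕ) : ℕ∞ω) = (m : ℕ∞ω) + 1 := by push_cast; rfl
    rw [hcast, contDiffOn_succ_iff_deriv_of_isOpen isOpen_Ioi]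
    refine ⟨differentiableOn_cutoffWFamily n, fun h ↦ absurd h (by simp), ?_⟩
    refine (ih (n + 1)).neg.congr fun y hy ↦ ?_
    exact deriv_cutoffWFamily n (mem_Ioi.mp hy)

/-- **Every `W_n` is `C^∞` on `(0, ∞)`.** [cite: KowalskiMichelVanderKam2000, (22) p. 12] -/
theorem contDiffOn_cutoffWFamily (n : ℕ) :
    ContDiffOn ℝ ∞ (fun y : ℝ ↦ ∫ u in Ioi (0 : ℝ), (u ^ n)⁻¹ * Real.exp (-u - y / u)) (Ioi 0) :=
  contDiffOn_infty.mpr fun m ↦ contDiffOn_cutoffWFamily_nat m n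

/-- `W = W_0`. [cite: KowalskiMichelVanderKam2000, (21) p. 12] -/
theorem cutoffW_eq_family_zero :
    cutoffW = fun y : ℝ ↦ ∫ u in Ioi (0 : ℝ), (u ^ 0)⁻¹ * Real.exp (-u - y / u) := by
  funext y
  simp only [cutoffW, pow_zero, inv_one, one_mul]

/-- **KMV's cut-off `W` is `C^∞` on `(0, ∞)`** (printed (22): «smooth and decays faster than any negative
power of `y`»). [cite: KowalskiMichelVanderKam2000, (22) p. 12] -/
theorem contDiffOn_cutoffW : ContDiffOn ℝ ∞ cutoffW (Ioi 0) := by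
  rw [cutoffW_eq_family_zero]
  exact contDiffOn_cutoffWFamily 0

/-- `W` is `C^m` on `(0,∞)` for every `m : ℕ∞` (convenience). [cite: KowalskiMichelVanderKam2000, (22) p. 12] -/
theorem contDiffOn_cutoffW_of_le {m : ℕ∞} : ContDiffOn ℝ m cutoffW (Ioi 0) :=
  contDiffOn_cutoffW.of_le (by exact_mod_cast le_top)

/-- `W` is `C^∞` at every `y > 0`. [cite: KowalskiMichelVanderKam2000, (22) p. 12] -/
theorem contDiffAt_cutoffW {y : ℝ} (hy : 0 < y) : ContDiffAt ℝ ∞ cutoffW y :=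
  contDiffOn_cutoffW.contDiffAt (Ioi_mem_nhds hy)

/-- **`W'(y) = −∫₀^∞ u^{−1} e^{−u−y/u} du`** for `y > 0` (`= −2K₀(2√y)`).
[cite: KowalskiMichelVanderKam2000, (21)–(22) p. 12] -/
theorem hasDerivAt_cutoffW {y : ℝ} (hy : 0 < y) :
    HasDerivAt cutoffW (-(∫ u in Ioi (0 : ℝ), u⁻¹ * Real.exp (-u - y / u))) y := by
  have h := hasDerivAt_cutoffWFamily 0 hy
  simp only [zero_add, pow_one] at h
  rw [cutoffW_eq_family_zero]
  exact h

/-- `W` is differentiable on `(0,∞)`. [cite: KowalskiMichelVanderKam2000, (22) p. 12] -/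
theorem differentiableOn_cutoffW : DifferentiableOn ℝ cutoffW (Ioi 0) :=
  fun _ hy ↦ (hasDerivAt_cutoffW (mem_Ioi.mp hy)).differentiableAt.differentiableWithinAt

/-- `W` is continuous on `(0,∞)`. [cite: KowalskiMichelVanderKam2000, (22) p. 12] -/
theorem continuousOn_cutoffW_Ioi : ContinuousOn cutoffW (Ioi 0) :=
  differentiableOn_cutoffW.continuousOn

/-- The derivative is non-positive: `W' ≤ 0` on `(0,∞)` (consistent with `cutoffW_antitoneOn`).
[cite: KowalskiMichelVanderKam2000, (22) p. 12] -/
theorem deriv_cutoffW_nonpos {y : ℝ} (hy : 0 < y) : deriv cutoffW y ≤ 0 := by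
  rw [(hasDerivAt_cutoffW hy).deriv, neg_nonpos]
  exact setIntegral_nonneg measurableSet_Ioi fun u hu ↦ by
    have : 0 < u := mem_Ioi.mp hu
    positivity

end Literature.NumberTheory.LFunctions.KMV2000
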